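import Mathlib

/-!
# Generic leaf-nondegeneracy (stub B of crux `WindLine.WindyGalerkinSteadyZerothLaw`,
# stmt-AnomalousDissipation-11414), tools E: Riesz–Schauder theory of `c·1 + C`, `C` compact (part 1)

Helper layer (pure proof file, no definitions; abstract functional analysis on a real Banach space
`E`).  For a continuous linear `S` with `S x = c x + C x`, `C` compact, `c ≠ 0`:

* `finiteDimensional_ker` — `ker S` is finite-dimensional (its unit ball lies in `c⁻¹ C(ball)`);
* `exists_antilipschitz_compl`, `isClosed_range_of_compact` — `S` is bounded below on a closed
  complement of its kernel, hence `range S` is closed;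
* `injective_of_surjective` — the Riesz-lemma half of the Fredholm alternative missing from Mathlib
  (which has `IsCompactOperator.hasEigenvalue_or_mem_resolventSet`: injective ⇒ surjective): if `S` is
  surjective it is injective (otherwise the kernels of the iterates `Sᵏ` increase strictly, and Riesz's
  lemma produces a bounded sequence on which `C` has no Cauchy subsequence).

References: Kress, *Linear Integral Equations*, Ch. 3 (Riesz theory); Brezis, *Functional Analysis*,
Thm. 6.6 (Fredholm alternative); T. Tao, blog notes on the Fredholm alternative (2011).
-/

noncomputable section

-- D-0017: single-problem summit ⇒ the duplicated namespace segment is by design.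
set_option linter.dupNamespace false

open scoped Topology NNReal Pointwise
open Filter Set Function

namespace Summit.AnomalousDissipation.AnomalousDissipation.Theorems.WindLineWindyGalerkinSteadyZerothLaw.GenericLeaf

section Fredholm

variable {E : Type*} [NormedAddCommGroup E] [NormedSpace ℝ E] [CompleteSpace E]
variable {C S : E →L[ℝ] E} {c : ℝ}

/-! ## §1 The kernel is finite-dimensional -/

omit [CompleteSpace E] in
/-- **The kernel of `c·1 + C` is finite-dimensional** (`C` compact, `c ≠ 0`): the closed unit ball of
the kernel is contained in `−c⁻¹ C(closed unit ball)`, a relatively compact set. [folklore] -/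
theorem finiteDimensional_ker (hC : IsCompactOperator C) (hc : c ≠ 0) (hS : ∀ x, S x = c • x + C x) :
    FiniteDimensional ℝ (LinearMap.ker (S : E →ₗ[ℝ] E)) := by
  set K := LinearMap.ker (S : E →ₗ[ℝ] E) with hK
  obtain ⟨Q, hQc, hQ⟩ := hC.image_closedBall_subset_compact 1
  have hemb : Topology.IsEmbedding (Subtype.val : K → E) := Topology.IsEmbedding.subtypeVal
  refine FiniteDimensional.of_isCompact_closedBall₀ ℝ (r := 1) one_pos ?_
  rw [hemb.isCompact_iff]
  -- the image of the unit ball of `K` is closed and contained in `(-c⁻¹) • Q`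
  have hsub : (Subtype.val : K → E) '' Metric.closedBall (0 : K) 1 ⊆ (-c⁻¹) • Q := by
    rintro _ ⟨v, hv, rfl⟩
    have hv0 : S (v : E) = 0 := v.2
    rw [hS] at hv0
    have e : (v : E) = (-c⁻¹) • C (v : E) := by
      have : c • (v : E) = -C (v : E) := eq_neg_of_add_eq_zero_left hv0
      calc (v : E) = c⁻¹ • (c • (v : E)) := by rw [smul_smul, inv_mul_cancel₀ hc, one_smul]
        _ = (-c⁻¹) • C (v : E) := by rw [this, smul_neg, neg_smul]
    rw [e]
    refine Set.smul_mem_smul_set (hQ ⟨(v : E), ?_, rfl⟩)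
    simpa using hv
  have hclosed : IsClosed ((Subtype.val : K → E) '' Metric.closedBall (0 : K) 1) := by
    have e : (Subtype.val : K → E) '' Metric.closedBall (0 : K) 1 = Metric.closedBall (0 : E) 1 ∩ (K : Set E) := by
      ext y
      constructor
      · rintro ⟨v, hv, rfl⟩
        exact ⟨by simpa using hv, v.2⟩
      · rintro ⟨hy, hyK⟩
        exact ⟨⟨y, hyK⟩, by simpa using hy, rfl⟩
    rw [e]
    exact Metric.isClosed_closedBall.inter (ContinuousLinearMap.isClosed_ker S)
  exact (hQc.smul (-c⁻¹)).of_isClosed_subset hclosed hsub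

/-! ## §2 The range is closed -/

omit [CompleteSpace E] in
/-- **`c·1 + C` is bounded below on a closed complement of its kernel.**  If `N` is a closed subspace
with `N ⊓ ker S = ⊥`, there is `γ > 0` with `γ‖v‖ ≤ ‖S v‖` on `N`; otherwise unit vectors `vₙ ∈ N`
with `S vₙ → 0` have `C vₙ` convergent along a subsequence, so `vₙ = c⁻¹(S vₙ − C vₙ)` converges to a
unit vector of `N ∩ ker S`. [folklore] -/
theorem exists_bound_below_of_inf_ker_eq_bot (hC : IsCompactOperator C) (hc : c ≠ 0) (hS : ∀ x, S x = c • x + C x)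
    (N : Submodule ℝ E) (hNc : IsClosed (N : Set E)) (hN : N ⊓ LinearMap.ker (S : E →ₗ[ℝ] E) = ⊥) :
    ∃ γ : ℝ, 0 < γ ∧ ∀ v ∈ N, γ * ‖v‖ ≤ ‖S v‖ := by
  by_contra h
  simp only [not_exists, not_and, not_forall, not_le, exists_prop] at h
  -- unit vectors `v n ∈ N` with `‖S (v n)‖ < 1/(n+1)`
  have hv : ∀ n : ℕ, ∃ v ∈ N, ‖v‖ = 1 ∧ ‖S v‖ < 1 / (n + 1) := by
    intro n
    obtain ⟨w, hwN, hw⟩ := h (1 / (n + 1)) (by positivity)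
    have hw0 : w ≠ 0 := by
      intro h0; rw [h0] at hw; simp at hw
    have hwn : 0 < ‖w‖ := norm_pos_iff.2 hw0
    refine ⟨‖w‖⁻¹ • w, N.smul_mem _ hwN, by rw [norm_smul, norm_inv, norm_norm, inv_mul_cancel₀ hwn.ne'], ?_⟩
    rw [map_smul, norm_smul, norm_inv, norm_norm, inv_mul_lt_iff₀ hwn]
    linarith
  choose v hvN hv1 hvS using hv
  -- `S (v n) → 0`
  have hS0 : Tendsto (fun n => S (v n)) atTop (𝓝 0) := by
    rw [tendsto_zero_iff_norm_tendsto_zero]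
    refine squeeze_zero (fun n => norm_nonneg _) (fun n => (hvS n).le) ?_
    exact tendsto_one_div_add_atTop_nhds_zero_nat
  -- `C (v n)` has a convergent subsequence
  obtain ⟨Q, hQc, hQ⟩ := hC.image_closedBall_subset_compact 1
  have hmem : ∀ n, C (v n) ∈ Q := fun n => hQ ⟨v n, by simp [hv1 n], rfl⟩
  obtain ⟨y, -, φ, hφ, hy⟩ := hQc.tendsto_subseq hmem
  -- then `v (φ n) → -c⁻¹ y`
  have hvlim : Tendsto (fun n => v (φ n)) atTop (𝓝 ((-c⁻¹) • y)) := by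
    have e : ∀ n, v (φ n) = c⁻¹ • (S (v (φ n)) - C (v (φ n))) := fun n => by
      rw [hS, add_sub_cancel_right, smul_smul, inv_mul_cancel₀ hc, one_smul]
    have h1 : Tendsto (fun n => S (v (φ n)) - C (v (φ n))) atTop (𝓝 (0 - y)) :=
      (hS0.comp hφ.tendsto_atTop).sub hy
    have h2 := h1.const_smul c⁻¹
    rw [zero_sub, smul_neg, ← neg_smul] at h2
    exact h2.congr fun n => (e n).symm
  set z : E := (-c⁻¹) • y with hz
  have hzN : z ∈ N := hNc.mem_of_tendsto hvlim (Eventually.of_forall fun n => hvN _)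
  have hz1 : ‖z‖ = 1 := by
    have h := (continuous_norm.tendsto z).comp hvlim
    have h' : Tendsto (fun n => ‖v (φ n)‖) atTop (𝓝 1) := by simp_rw [hv1]; exact tendsto_const_nhds
    exact tendsto_nhds_unique h h'
  have hzS : S z = 0 := by
    have h := (S.continuous.tendsto z).comp hvlim
    exact tendsto_nhds_unique h (hS0.comp hφ.tendsto_atTop)
  have hzK : z ∈ N ⊓ LinearMap.ker (S : E →ₗ[ℝ] E) := ⟨hzN, hzS⟩
  rw [hN] at hzK
  rw [(Submodule.mem_bot ℝ).1 hzK, norm_zero] at hz1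
  exact zero_ne_one hz1

/-- **The range of `c·1 + C` is closed** (`C` compact, `c ≠ 0`): with `N` a closed complement of the
finite-dimensional kernel, `range S = S(N)` and `S|_N` is antilipschitz. [folklore] -/
theorem isClosed_range_of_compact (hC : IsCompactOperator C) (hc : c ≠ 0) (hS : ∀ x, S x = c • x + C x) :
    IsClosed ((LinearMap.range (S : E →ₗ[ℝ] E) : Submodule ℝ E) : Set E) := by
  haveI := finiteDimensional_ker hC hc hS
  set K := LinearMap.ker (S : E →ₗ[ℝ] E) with hK
  obtain ⟨N, hNc, hKN⟩ := (Submodule.ClosedComplemented.of_finiteDimensional K).exists_isClosed_isCompl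
  obtain ⟨γ, hγ, hbound⟩ := exists_bound_below_of_inf_ker_eq_bot hC hc hS N hNc (by rw [inf_comm]; exact hKN.inf_eq_bot)
  -- `range S = range (S ∘ N.subtype)`
  haveI : CompleteSpace N := hNc.completeSpace_coe
  set SN : N →L[ℝ] E := S.comp N.subtypeL with hSN
  have hrange : ((LinearMap.range (S : E →ₗ[ℝ] E) : Submodule ℝ E) : Set E) = Set.range SN := by
    ext y
    constructor
    · rintro ⟨x, rfl⟩
      -- decompose `x = k + n`
      have hx : x ∈ K ⊔ N := by rw [hKN.sup_eq_top]; trivial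
      obtain ⟨k, hk, n, hn, rfl⟩ := Submodule.mem_sup.1 hx
      refine ⟨⟨n, hn⟩, ?_⟩
      change S n = S (k + n)
      rw [map_add, show S k = 0 from hk, zero_add]
    · rintro ⟨n, rfl⟩
      exact ⟨(n : E), rfl⟩
  rw [hrange]
  have hanti : AntilipschitzWith (Real.toNNReal γ⁻¹) SN := by
    refine AntilipschitzWith.of_le_mul_dist fun a b => ?_
    rw [dist_eq_norm, dist_eq_norm, ← map_sub, Real.coe_toNNReal _ (inv_nonneg.2 hγ.le)]
    have h := hbound ((a - b : N) : E) (a - b).2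
    rw [Submodule.coe_sub] at h
    change ‖(a : E) - b‖ ≤ γ⁻¹ * ‖S ((a : E) - b)‖
    rw [le_inv_mul_iff₀ hγ]
    exact h
  exact hanti.isClosed_range SN.uniformContinuous

/-! ## §3 Surjective implies injective -/

omit [CompleteSpace E] in
/-- Iterates: `Sᵏ⁺¹ x = Sᵏ (S x)`. [folklore] -/
theorem pow_succ_apply (S : E →L[ℝ] E) (k : ℕ) (x : E) : (S ^ (k + 1)) x = (S ^ k) (S x) := by
  rw [pow_succ]; rfl

omit [CompleteSpace E] in
/-- Iterates: `Sᵏ⁺¹ x = S (Sᵏ x)`. [folklore] -/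
theorem pow_succ_apply' (S : E →L[ℝ] E) (k : ℕ) (x : E) : (S ^ (k + 1)) x = S ((S ^ k) x) := by
  rw [pow_succ']; rfl

omit [CompleteSpace E] in
/-- The iterated kernels `ker Sᵏ` increase with `k`. [folklore] -/
theorem ker_pow_mono (S : E →L[ℝ] E) : Monotone fun k => LinearMap.ker ((S ^ k : E →L[ℝ] E) : E →ₗ[ℝ] E) := by
  refine monotone_nat_of_le_succ fun k x hx => ?_
  change (S ^ (k + 1)) x = 0
  rw [pow_succ_apply', show (S ^ k) x = 0 from hx, map_zero]

omit [CompleteSpace E] in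
/-- `S` maps `ker Sᵏ⁺¹` into `ker Sᵏ`. [folklore] -/
theorem map_mem_ker_pow (S : E →L[ℝ] E) {k : ℕ} {x : E}
    (hx : x ∈ LinearMap.ker ((S ^ (k + 1) : E →L[ℝ] E) : E →ₗ[ℝ] E)) :
    S x ∈ LinearMap.ker ((S ^ k : E →L[ℝ] E) : E →ₗ[ℝ] E) := by
  change (S ^ k) (S x) = 0
  rw [← pow_succ_apply]
  exact hx

omit [CompleteSpace E] in
/-- **Riesz's lemma between consecutive iterated kernels**: if `ker Sᵏ ≠ ker Sᵏ⁺¹` there is a unit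
vector of `ker Sᵏ⁺¹` at distance `≥ 1/2` from `ker Sᵏ`. [folklore] -/
theorem exists_unit_far (S : E →L[ℝ] E) (k : ℕ) {v : E}
    (hv1 : v ∈ LinearMap.ker ((S ^ (k + 1) : E →L[ℝ] E) : E →ₗ[ℝ] E))
    (hv0 : v ∉ LinearMap.ker ((S ^ k : E →L[ℝ] E) : E →ₗ[ℝ] E)) :
    ∃ y ∈ LinearMap.ker ((S ^ (k + 1) : E →L[ℝ] E) : E →ₗ[ℝ] E), ‖y‖ = 1 ∧
      ∀ z ∈ LinearMap.ker ((S ^ k : E →L[ℝ] E) : E →ₗ[ℝ] E), 1 / 2 ≤ ‖y - z‖ := by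
  set N₀ := LinearMap.ker ((S ^ k : E →L[ℝ] E) : E →ₗ[ℝ] E) with hN₀
  set N₁ := LinearMap.ker ((S ^ (k + 1) : E →L[ℝ] E) : E →ₗ[ℝ] E) with hN₁
  set F : Submodule ℝ N₁ := N₀.comap N₁.subtype with hF
  have hFc : IsClosed (F : Set N₁) :=
    (ContinuousLinearMap.isClosed_ker (S ^ k)).preimage continuous_subtype_val
  have hFne : ∃ x : N₁, x ∉ F := ⟨⟨v, hv1⟩, hv0⟩
  obtain ⟨x₀, hx₀F, hx₀⟩ := riesz_lemma hFc hFne (by norm_num : (1 / 2 : ℝ) < 1)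
  have hx₀0 : x₀ ≠ 0 := fun h => hx₀F (by rw [h]; exact F.zero_mem)
  have hn : 0 < ‖x₀‖ := norm_pos_iff.2 hx₀0
  refine ⟨‖x₀‖⁻¹ • (x₀ : E), N₁.smul_mem _ x₀.2, ?_, fun z hz => ?_⟩
  · rw [norm_smul, norm_inv, norm_norm, ← Submodule.coe_norm, inv_mul_cancel₀ hn.ne']
  · have hzN₁ : ‖x₀‖ • z ∈ N₁ := N₁.smul_mem _ (ker_pow_mono S (Nat.le_succ k) hz)
    have hmem : (⟨‖x₀‖ • z, hzN₁⟩ : N₁) ∈ F := by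
      change ((⟨‖x₀‖ • z, hzN₁⟩ : N₁) : E) ∈ N₀
      exact N₀.smul_mem _ hz
    have h := hx₀ _ hmem
    have h' : 1 / 2 * ‖(x₀ : E)‖ ≤ ‖(x₀ : E) - ‖(x₀ : E)‖ • z‖ := by
      have e1 : ‖x₀ - (⟨‖x₀‖ • z, hzN₁⟩ : N₁)‖ = ‖(x₀ : E) - ‖(x₀ : E)‖ • z‖ := rfl
      have e2 : ‖x₀‖ = ‖(x₀ : E)‖ := rfl
      rw [e1, e2] at h
      exact h
    have hn' : 0 < ‖(x₀ : E)‖ := hn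
    have e : ‖x₀‖⁻¹ • (x₀ : E) - z = ‖(x₀ : E)‖⁻¹ • ((x₀ : E) - ‖(x₀ : E)‖ • z) := by
      rw [smul_sub, smul_smul, inv_mul_cancel₀ hn'.ne', one_smul]
      rfl
    rw [e, norm_smul, norm_inv, norm_norm, le_inv_mul_iff₀ hn']
    linarith

omit [CompleteSpace E] in
/-- **Surjective ⇒ injective for `c·1 + C`, `C` compact, `c ≠ 0`** (the Riesz-lemma half of the
Fredholm alternative).  If `S` were surjective but not injective, the kernels `ker Sᵏ` would
increase strictly (pull a non-zero kernel vector back along `S`), Riesz's lemma would give unit vectors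
`yₖ ∈ ker Sᵏ⁺¹` at distance `≥ 1/2` from `ker Sᵏ`, and then `‖C yₖ − C yⱼ‖ ≥ |c|/2` for `j < k`
(`C = S − c`), contradicting the compactness of `C`. [folklore] -/
theorem injective_of_surjective (hC : IsCompactOperator C) (hc : c ≠ 0) (hS : ∀ x, S x = c • x + C x)
    (hsurj : Function.Surjective S) : Function.Injective S := by
  refine (injective_iff_map_eq_zero S).2 fun v₁ hv₁ => ?_
  by_contra hv₁0
  -- pull `v₁` back along `S`
  set v : ℕ → E := fun k => Nat.rec v₁ (fun _ w => Function.surjInv hsurj w) k with hvdef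
  have hv0 : v 0 = v₁ := rfl
  have hvS : ∀ k, S (v (k + 1)) = v k := fun k => Function.surjInv_eq hsurj (v k)
  have hpow : ∀ k, (S ^ k) (v k) = v₁ := by
    intro k
    induction k with
    | zero => simp [hv0]
    | succ k ih => rw [pow_succ_apply, hvS, ih]
  have hmem : ∀ k, v k ∈ LinearMap.ker ((S ^ (k + 1) : E →L[ℝ] E) : E →ₗ[ℝ] E) := fun k => by
    change (S ^ (k + 1)) (v k) = 0
    rw [pow_succ_apply', hpow, hv₁]
  have hnot : ∀ k, v k ∉ LinearMap.ker ((S ^ k : E →L[ℝ] E) : E →ₗ[ℝ] E) := fun k h => by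
    have h' : (S ^ k) (v k) = 0 := h
    rw [hpow] at h'
    exact hv₁0 h'
  -- Riesz unit vectors
  choose y hyN hy1 hyfar using fun k => exists_unit_far S k (hmem k) (hnot k)
  -- separation of the images under `C`
  have hCx : ∀ x, C x = S x - c • x := fun x => by rw [hS]; abel
  have hsep : ∀ j k, j < k → |c| / 2 ≤ ‖C (y k) - C (y j)‖ := by
    intro j k hjk
    set z : E := y j + c⁻¹ • (S (y k) - S (y j)) with hz
    have hzN : z ∈ LinearMap.ker ((S ^ k : E →L[ℝ] E) : E →ₗ[ℝ] E) := by
      refine Submodule.add_mem _ (ker_pow_mono S (Nat.succ_le_of_lt hjk) (hyN j)) (Submodule.smul_mem _ _ ?_)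
      refine Submodule.sub_mem _ (map_mem_ker_pow S (hyN k)) ?_
      exact ker_pow_mono S (Nat.le_of_lt hjk) (map_mem_ker_pow S (hyN j))
    have e : C (y k) - C (y j) = (-c) • (y k - z) := by
      rw [hCx, hCx, hz, smul_sub, smul_add, smul_smul, neg_mul, mul_inv_cancel₀ hc]
      simp only [neg_smul, one_smul]
      abel
    rw [e, norm_smul, norm_neg, Real.norm_eq_abs]
    have h := hyfar k z hzN
    have hc' : 0 < |c| := abs_pos.2 hc
    calc |c| / 2 = |c| * (1 / 2) := by ring
      _ ≤ |c| * ‖y k - z‖ := mul_le_mul_of_nonneg_left h hc'.le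
  -- compactness of `C` on the unit ball
  obtain ⟨Q, hQc, hQ⟩ := hC.image_closedBall_subset_compact 1
  have hyQ : ∀ k, C (y k) ∈ Q := fun k => hQ ⟨y k, by simp [hy1 k], rfl⟩
  obtain ⟨w, -, φ, hφ, hw⟩ := hQc.tendsto_subseq hyQ
  have hcau := hw.cauchySeq
  rw [Metric.cauchySeq_iff'] at hcau
  obtain ⟨N, hN⟩ := hcau (|c| / 2) (by positivity)
  have h := hN (N + 1) (Nat.le_succ N)
  rw [dist_eq_norm] at h
  exact (not_lt.2 (hsep (φ N) (φ (N + 1)) (hφ (Nat.lt_succ_self N)))) h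

end Fredholm

/-! ## §4 Registered sub-goal -/

/-- **Registered sub-goal `genericLeaf_toolsE`** (worker B of stub `stub_genericLeafNondegeneracy`):
surjective ⇒ injective for `c·1 + compact`, `injective_of_surjective` in Pi-form. [folklore] -/
theorem genericLeaf_toolsE : ∀ {E : Type*} [NormedAddCommGroup E] [NormedSpace ℝ E] {C S : E →L[ℝ] E} {c : ℝ}, IsCompactOperator C → c ≠ 0 → (∀ x, S x = c • x + C x) → Function.Surjective S → Function.Injective S :=
  fun hC hc hS hsurj => injective_of_surjective hC hc hS hsurj

end Summit.AnomalousDissipation.AnomalousDissipation.Theorems.WindLineWindyGalerkinSteadyZerothLaw.GenericLeaf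

end
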